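import Mathlib
import Summits.ValiantsHypothesis.ValiantsHypothesis.Theorems.LacunarySymmetroidMatrixDescartesFlagTwoStep
import Summits.ValiantsHypothesis.ValiantsHypothesis.Theorems.LacunarySymmetroidMatrixDescartesTwoSidedLoewner

/-!
# `MatrixDescartes` (stmt-ValiantsHypothesis-18050) — THREE LETTERS WITH A SINGULAR MIDDLE LETTER: for
# `X^aS₋ + X^bS₀ + X^cS₊` (`a < b < c`, `S₊ ⪰ 0`, `S₋ ⪯ 0`, `S₀` ARBITRARY symmetric) the positive zeros counted with
# multiplicity satisfy `Z₊ + ν(S₀|ker S₊) = ν(S₋) + ν(S₀|ker S₋)` whenever the two compressions are non-singular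

HONEST FRAMING.  Cell `pub-symmetroid`, seat `val-sym-mdr-p2` (gen 21); helper file `--supports` the crux
`Theses.LacunarySymmetroid.MatrixDescartes` (OPEN), NO closure claim; assembles the two-step flags (`…FlagTwoStep`:
`Inertia.flag_twoStep_indices_eq`, `…_zero`) with the two-sided Loewner rung in window form (`…TwoSidedLoewner`:
`GramDual.monotone_pencil_card_posRoots_multiset_eq_window`).  An EXACT COUNT on the three-letter monotone sector WITHOUT
inverting the middle letter (companion of `…ThreeLetters`, where `det S₀ ≠ 0` and the count is `ν(S₊S₀⁻¹S₊) + π(S₋S₀⁻¹S₋)`);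
nothing here bears on the crux in its window, `stub_twoSided`, `DoorA26` / `DoorA34`, registers, or `VP ≠ VNP`.

* **`threeLetters_singular_card_posRoots_multiset_eq`.**  Letters `S 0 = S₋, S 1 = S₀, S 2 = S₊` real symmetric `m × m` at
  exponents `d 0 < d 1 < d 2`, `S₊ ⪰ 0`, `−S₋ ⪰ 0`;
  `D₊ = (U₊ᵀS₀U₊)|_{ker S₊}` and `D₋ = (U₋ᵀS₀U₋)|_{ker S₋}` the compressions of `S₀` to the kernels of the outer letters (in their
  eigenbases), both NON-SINGULAR.  Then the positive zeros of `det(X^aS₋ + X^bS₀ + X^cS₊)` counted with multiplicity satisfy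
  `Z₊ + ν(D₊) = ν(S₋) + ν(D₋)` (and `ν(S₋) = rank S₋`).  Example (`m = 2`, `S₋ = −e₁e₁ᵀ`, `S₊ = e₂e₂ᵀ`,
  `S₀ = [[p, q],[q, r]]`, `p, r ≠ 0`): `Z₊ = 1 + [r < 0] − [p < 0]` for every `q` and all exponents.
PROOF.  End inertias `ν(F(∞)) = ν(S₊) + ν(D₊) = ν(D₊)` and `ν(F(0⁺)) = ν(S₋) + ν(D₋)` by the two flags; every positive root lies
between the two non-singular end scales; the count is the inertia drop (positive type, no invertibility).

[folklore] (Sylvester's law along a monotone family; continuity of the spectrum).  Axioms `propext`, `Classical.choice`,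
`Quot.sound`.  No definitions.
-/

-- layout Summits/ValiantsHypothesis/ValiantsHypothesis forces the duplicated namespace component
set_option linter.dupNamespace false

namespace Summit.ValiantsHypothesis.ValiantsHypothesis.Theorems.LacunarySymmetroidMatrixDescartes

open Polynomial Matrix Finset
open scoped BigOperators Topology

namespace GramDual

variable {m : ℕ}

/-- A PSD real matrix has no negative eigenvalue. [folklore] -/
theorem negIndex_eq_zero_of_posSemidef {A : Matrix (Fin m) (Fin m) ℝ} (hA : A.IsHermitian) (hP : A.PosSemidef) :
    Fintype.card {j // hA.eigenvalues j < 0} = 0 :=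
  Fintype.card_eq_zero_iff.2 ⟨fun j => absurd (eigenvalues_nonneg_of_posSemidef' hA hP j.1) (not_le.2 j.2)⟩

/-- **THREE LETTERS WITH A SINGULAR MIDDLE LETTER.**  Letters `S 0 = S₋`, `S 1 = S₀`, `S 2 = S₊` real symmetric at exponents
`d 0 < d 1 < d 2`, `S₊ ⪰ 0`, `−S₋ ⪰ 0`, the compressions `D₊ = S₀|ker S₊`, `D₋ = S₀|ker S₋` (eigenbases of `S₊`, `S₋`)
non-singular: the positive zeros of `det(Σ_l X^{d_l}S_l)` counted with multiplicity satisfy `Z₊ + ν(D₊) = ν(S₋) + ν(D₋)`.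
[folklore] -/
theorem threeLetters_singular_card_posRoots_multiset_eq (d : Fin 3 → ℕ) (S : Fin 3 → Matrix (Fin m) (Fin m) ℝ)
    (hS : ∀ l, (S l).IsHermitian) (h01 : d 0 < d 1) (h12 : d 1 < d 2) (hp : (S 2).PosSemidef) (hn : (-(S 0)).PosSemidef)
    (hDp : IsUnit ((((hS 2).eigenvectorUnitary : Matrix (Fin m) (Fin m) ℝ)ᵀ * S 1
        * ((hS 2).eigenvectorUnitary : Matrix (Fin m) (Fin m) ℝ)).submatrix
        (fun i : {i : Fin m // (hS 2).eigenvalues i = 0} => i.1) (fun i : {i : Fin m // (hS 2).eigenvalues i = 0} => i.1)).det)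
    (hDn : IsUnit ((((hS 0).eigenvectorUnitary : Matrix (Fin m) (Fin m) ℝ)ᵀ * S 1
        * ((hS 0).eigenvectorUnitary : Matrix (Fin m) (Fin m) ℝ)).submatrix
        (fun i : {i : Fin m // (hS 0).eigenvalues i = 0} => i.1) (fun i : {i : Fin m // (hS 0).eigenvalues i = 0} => i.1)).det) :
    Multiset.card ((Matrix.det (∑ l, ((Polynomial.X : Polynomial ℝ) ^ d l) • (S l).map Polynomial.C)).roots.filter
        (fun t => 0 < t))
      + Fintype.card {j // (Inertia.isHermitian_compression S hS 2 1).eigenvalues j < 0}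
      = Fintype.card {j // (hS 0).eigenvalues j < 0}
        + Fintype.card {j // (Inertia.isHermitian_compression S hS 0 1).eigenvalues j < 0} := by
  classical
  have hSs : ∀ l, (S l).IsSymm := fun l => isSymm_of_isHermitian_real (hS l)
  set P := Matrix.det (∑ l, ((Polynomial.X : Polynomial ℝ) ^ d l) • (S l).map Polynomial.C) with hPdef
  -- the two flags
  obtain ⟨N, hN, hN'⟩ := Inertia.flag_twoStep_indices_eq d S hS 2 1 h12
    (fun l h2 h1 => by fin_cases l <;> simp_all) hDp hSs
  obtain ⟨ε, hε, hε'⟩ := Inertia.flag_twoStep_indices_eq_zero d S hS 0 1 h01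
    (fun l h0 h1 => by fin_cases l <;> simp_all) hDn hSs
  -- monotonicity data
  have hmono : ∀ l : Fin 3, l ≠ 1 → ((S l).PosSemidef ∧ d 1 < d l) ∨ ((-(S l)).PosSemidef ∧ d l < d 1) := by
    intro l hl; fin_cases l
    · exact Or.inr ⟨hn, h01⟩
    · exact absurd rfl hl
    · exact Or.inl ⟨hp, h12⟩
  -- `P ≠ 0`
  have hP0 : P ≠ 0 := by
    intro h0
    apply (hN' N le_rfl).2.2
    rw [← DefiniteMoments.eval_det_pencil, ← hPdef, h0, Polynomial.eval_zero]
  -- end scales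
  set a' : ℝ := ε / 2 with ha'def
  set b' : ℝ := N + 1 + (P.roots.toFinset.sum fun t => |t|) with hb'def
  have ha'pos : 0 < a' := by rw [ha'def]; positivity
  have hsumnn : 0 ≤ P.roots.toFinset.sum fun t => |t| := Finset.sum_nonneg fun t _ => abs_nonneg t
  have hNb : N ≤ b' := by rw [hb'def]; linarith
  have hroot_lt : ∀ t ∈ P.roots, t < b' := by
    intro t ht
    have h1 : |t| ≤ P.roots.toFinset.sum fun t => |t| :=
      Finset.single_le_sum (f := fun t => |t|) (fun t _ => abs_nonneg t) (Multiset.mem_toFinset.2 ht)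
    have h2 : t ≤ |t| := le_abs_self t
    rw [hb'def]; linarith
  have hroot_ge : ∀ t ∈ P.roots, 0 < t → ε ≤ t := by
    intro t ht hpos
    by_contra h
    push Not at h
    apply (hε' t hpos h).2.2
    rw [← DefiniteMoments.eval_det_pencil, ← hPdef]
    exact (Polynomial.mem_roots hP0).1 ht
  have hνSp : Fintype.card {j // (hS 2).eigenvalues j < 0} = 0 := negIndex_eq_zero_of_posSemidef (hS 2) hp
  rcases lt_or_ge a' b' with hab' | hba'
  swap
  · -- degenerate placement: no positive roots; both end formulas hold at `b'`
    have hbε : b' < ε := lt_of_le_of_lt hba' (by rw [ha'def]; linarith)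
    have h1 := (hε' b' (lt_of_lt_of_le hN hNb) hbε).1
    have h2 := (hN' b' hNb).1
    have hnone : P.roots.filter (fun t => 0 < t) = 0 := by
      refine Multiset.filter_eq_nil.2 fun t ht hpos => ?_
      have := hroot_ge t ht hpos; have := hroot_lt t ht; linarith
    rw [hnone, Multiset.card_zero]
    omega
  have ha : (∑ l, a' ^ d l • S l).det ≠ 0 := (hε' a' ha'pos (by rw [ha'def]; linarith)).2.2
  have hb : (∑ l, b' ^ d l • S l).det ≠ 0 := (hN' b' hNb).2.2
  have hwin := monotone_pencil_card_posRoots_multiset_eq_window d S hSs 1 hmono ha'pos hab' ha hb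
    (fun t ht hpos => ⟨by have := hroot_ge t ht hpos; rw [ha'def]; linarith, hroot_lt t ht⟩)
  rw [← hPdef] at hwin
  have hνa := (hε' a' ha'pos (by rw [ha'def]; linarith)).1
  have hνb := (hN' b' hNb).1
  omega

end GramDual

end Summit.ValiantsHypothesis.ValiantsHypothesis.Theorems.LacunarySymmetroidMatrixDescartes
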